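import Literature.MathematicalPhysics.QuantumFieldTheory.Balaban1983to89.B6DualHolderTermMultiLevelBox
import Literature.MathematicalPhysics.QuantumFieldTheory.Balaban1983to89.B6Prop22DualHolderTwoLevelBoxRateUnif

/-!
# `Balaban1983to89.B6DualHolderTermMultiLevelBoxRateUnif` — the per-term inputs of the FIFTH entry of (2.67)
# (`‖ζG′∇^{η*}λ‖_α`) for the GENUINE `k`-level operator (p21's `…B6DualHolderTermMultiLevelBox.aXt_dd_le` /
# `bXt_dd_le`) WITH THE RATES UNIFORM IN THE HÖLDER EXPONENT: `∃ δ ∀ α ∈ [0,1) ∃ Q(α)` — file 3 of the `k`-level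
# `_unif` re-threading (print's quantifier order, [3] p.573 «δ₀, c₀, R₀ … depending on d, M only, c₀ on α also»)

statement-level skeleton of published theorems with citation tags; proofs where landed; nothing here is a claim about the Yang–Mills mass gap

T. Bałaban, *Propagators and renormalization transformations for lattice gauge theories. II*, Commun. Math. Phys. **96**
(1984) 223–250 [Balaban1984PropagatorsII], Prop. 2.2 (2.67) p. 234 (fifth entry), (2.43)–(2.44) p. 230, (2.64)–(2.66)
p. 234; [3] [Balaban1983RegularityDecay] Theorem (1.9) p. 573.

CITATION HEADER (lean-in-tree rule).  Cell `lit-balaban`, unit `lit-balaban-r03` gen 13 (B6 fold owner, own lane), SKELETON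
row **B6.Prop2.2**.  Statements and proofs = p21 g11's `…B6DualHolderTermMultiLevelBox.aXt_dd_le` / `bXt_dd_le` (file 12
of the multi-level parametrix) VERBATIM with the ∃-witnesses reordered: the rates `δ₅ = min(δ″, δ_s, δ_d, δ_H)`,
`δ₆ = min(δ_a, δ_s, δ_d, δ_H, δ₇)` are minima of `α`-free rates once the COLUMN Hölder clause of (2.43) is taken in its
`_unif` form (`…B6Prop22DualHolderTwoLevelBoxRateUnif.ineq243_twoLevel_holderDual_wsum2_unif`, p323755); only the
constants `Q` see `c_H(α)`.  Everything else (`core_le`, `aXt_row_le`, `core_pair_le`, `bXt_pair_near_le`, `bXt_col_le`,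
the cube inputs `ineq243_twoLevel_roww` / `_dstar_roww` / `_deriv_wsum`, the two-centre (2.44) `wsum2_kComm_le`, the
geometry) is consumed BY NAME from p21's files; the private plumbing of the source (§1 Tools) is copied verbatim.
THEOREMS ONLY; no definition, no `def … : Prop` fact; nothing existing modified.

WHAT THIS FILE PROVES (kernel-checked; 0 sorry): `aXt_dd_le_unif` (∃ δ₅ ∀ α ∃ Q: one term of `G′₀ᵀ∂ᵀ` over a pair of rows
of one block, `≤ (L^j)^{1−α}·Q·e^{−δ₅d/(d+1)}·B`) and `bXt_dd_le_unif` (∃ δ₆ ∀ α ∃ Q: one term of `Rᵀ` on the level-weighted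
input over a pair of columns, `≤ (L^j)^{1−α}·(Q/M_h)·e^{−δ₆d/(d+1)}·B`).
HONEST SCOPE: as `…B6DualHolderTermMultiLevelBox` (lattice units, Neumann box, reading R2, windows); the uniformity in `α`
is the PRINTED quantifier order realised by re-threading, no new estimate.  NOT summit progress.
-/

namespace Literature.MathematicalPhysics.QuantumFieldTheory.Balaban1983to89.B6DualHolderTermMultiLevelBoxRateUnif

open Finset Matrix
open Literature.MathematicalPhysics.QuantumFieldTheory.Balaban1983to89.B4ContourShift (supNorm supNorm_nonneg
  abs_le_supNorm exists_supNorm_eq)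
open Literature.MathematicalPhysics.QuantumFieldTheory.Balaban1983to89.B4Reflection242 (boxDom mem_boxDom blk nbrs
  mem_nbrs)
open Literature.MathematicalPhysics.QuantumFieldTheory.Balaban1983to89.B4Lemma22ReduceZero (Box)
open Literature.MathematicalPhysics.QuantumFieldTheory.Balaban1983to89.B4Lemma22ZeroBoxDerivDual (fwd fwd_eq_of_nbr
  fwd_val_of_mem fwd_of_not_mem)
open Literature.MathematicalPhysics.QuantumFieldTheory.Balaban1983to89.B4PartitionUnity22 (hprof D1 D2 D1_nonneg D2_nonneg
  contDiff_hprof hasCompactSupport_hprof)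
open Literature.MathematicalPhysics.QuantumFieldTheory.Balaban1983to89.B4Thm110ZeroBox (boxCast boxCast_apply_val
  boxCast_symm_apply_val mem_boxDom_of_eq roww mulVec_le_of_roww supNorm_sub_le_sub_add_sub)
open Literature.MathematicalPhysics.QuantumFieldTheory.Balaban1983to89.B4Thm110ZeroBoxDeriv (wsum wsum_mul_left
  supNorm_single_le supNorm_sub_le_nbr)
open Literature.MathematicalPhysics.QuantumFieldTheory.Balaban1983to89.B4Thm19ZeroBoxHolder (wsum2 wsum2_nonneg
  wsum2_le_wsum_left wsum2_mono_rate)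
open Literature.MathematicalPhysics.QuantumFieldTheory.Balaban1983to89.B6Ineq243TwoLevelBox
open Literature.MathematicalPhysics.QuantumFieldTheory.Balaban1983to89.B6Ineq243AdjTwoLevelBox (dstar dstar_apply roww_dstar
  ineq243_twoLevel_dstar_roww)
open Literature.MathematicalPhysics.QuantumFieldTheory.Balaban1983to89.B6Partition236TwoLevelBox
open Literature.MathematicalPhysics.QuantumFieldTheory.Balaban1983to89.B6Eq238TwoLevelBox
open Literature.MathematicalPhysics.QuantumFieldTheory.Balaban1983to89.B6Ineq249TwoLevelBox (near card_near_le
  mem_near_of_abs_lt emb_sub_emb)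
open Literature.MathematicalPhysics.QuantumFieldTheory.Balaban1983to89.B6Prop22AdjTwoLevelBox (wsum_kComm_le
  kComm_transpose mul_kComm_apply hLoc_lipschitz hLoc_laplacian_le)
open Literature.MathematicalPhysics.QuantumFieldTheory.Balaban1983to89.B6Prop22DualHolderTwoLevelBox (wsum2_kComm_le
  cube_pair_wsum2_le cube_pair_diff_wsum2_le)
open Literature.MathematicalPhysics.QuantumFieldTheory.Balaban1983to89.B4Green242Bridge (boxNbrs)
open Literature.MathematicalPhysics.QuantumFieldTheory.Balaban1983to89.B6MultiLevelBoxOperator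
open Literature.MathematicalPhysics.QuantumFieldTheory.Balaban1983to89.B6Eq238MultiLevelBox
open Literature.MathematicalPhysics.QuantumFieldTheory.Balaban1983to89.B6Ineq249MultiLevelBox
open Literature.MathematicalPhysics.QuantumFieldTheory.Balaban1983to89.B6Geom246MultiLevelBox
open Literature.MathematicalPhysics.QuantumFieldTheory.Balaban1983to89.B6Prop22MultiLevelBox
open Literature.MathematicalPhysics.QuantumFieldTheory.Balaban1983to89.B6Prop22DerivMultiLevelBox (dMat
  dMat_mulVec_of_mem dMat_mulVec_of_not_mem img_of_uX_ne_zero mem_keySet_of_uX_ne_zero)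
open Literature.MathematicalPhysics.QuantumFieldTheory.Balaban1983to89.B6Prop22AdjMultiLevelBox (levW
  bX_transpose_mulVec_img bX_transpose_mulVec_off gX_apply_img gX_apply_off gX_symm aXt_dMatt_apply aXt_dMatt_apply_off)
open Literature.MathematicalPhysics.QuantumFieldTheory.Balaban1983to89.B6HolderTermMultiLevelBox (img_of_near
  supNorm_le_of_blkOf_eq)
open Literature.MathematicalPhysics.QuantumFieldTheory.Balaban1983to89.B6Prop22HolderTwoLevelBox (exists_emb_eq_of_near
  wsum_longDiff_le)
open Literature.MathematicalPhysics.QuantumFieldTheory.Balaban1983to89.B6Ineq243HolderDualTwoLevelBox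
  (ineq243_twoLevel_holderDual_wsum2)
open Literature.MathematicalPhysics.QuantumFieldTheory.Balaban1983to89.B6RandomWalk (HasMajorant BlockSupp
  hasMajorant_mono)
open Literature.MathematicalPhysics.QuantumFieldTheory.Balaban1983to89.B6DualHolderTermMultiLevelBox
open Literature.MathematicalPhysics.QuantumFieldTheory.Balaban1983to89.B6Prop22DualHolderTwoLevelBoxRateUnif
  (ineq243_twoLevel_holderDual_wsum2_unif)

noncomputable section

variable {d : ℕ}

/-! ## §1 Private plumbing copied verbatim from `…B6DualHolderTermMultiLevelBox` (private there) -/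

section Tools

/-- a weighted `ℓ¹` row bound gives decay against bounded vectors supported at (one- or two-centre) distance `≥ D`.
(verbatim private copy from `…B6DualHolderTermMultiLevelBox`) [folklore] -/
private theorem sum_mul_le_of_wrow {X : Type*} [Fintype X] {δ n c F Dd : ℝ} (hn : 0 < n) (hF0 : 0 ≤ F)
    (r u : X → ℝ) (dist : X → ℝ) (hrow : ∑ z, |r z| * Real.exp (δ * dist z / n) ≤ c)
    (hF : ∀ z, |u z| ≤ F) (hD : ∀ z, u z ≠ 0 → Dd ≤ dist z) (hδ : 0 ≤ δ) :
    |∑ z, r z * u z| ≤ c * Real.exp (-(δ * Dd / n)) * F := by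
  have hterm : ∀ z, |r z * u z| ≤ |r z| * Real.exp (δ * dist z / n) * (Real.exp (-(δ * Dd / n)) * F) := by
    intro z
    by_cases hz : u z = 0
    · rw [hz, mul_zero, abs_zero]; positivity
    rw [abs_mul]
    have h1 : 1 ≤ Real.exp (δ * dist z / n) * Real.exp (-(δ * Dd / n)) := by
      rw [← Real.exp_add]
      refine Real.one_le_exp ?_
      have := div_le_div_of_nonneg_right (mul_le_mul_of_nonneg_left (hD z hz) hδ) hn.le
      linarith
    calc |r z| * |u z| ≤ |r z| * (1 * F) := by
          rw [one_mul]; exact mul_le_mul_of_nonneg_left (hF z) (abs_nonneg _)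
      _ ≤ |r z| * (Real.exp (δ * dist z / n) * Real.exp (-(δ * Dd / n)) * F) :=
          mul_le_mul_of_nonneg_left (mul_le_mul_of_nonneg_right h1 hF0) (abs_nonneg _)
      _ = |r z| * Real.exp (δ * dist z / n) * (Real.exp (-(δ * Dd / n)) * F) := by ring
  calc |∑ z, r z * u z| ≤ ∑ z, |r z * u z| := Finset.abs_sum_le_sum_abs _ _
    _ ≤ ∑ z, |r z| * Real.exp (δ * dist z / n) * (Real.exp (-(δ * Dd / n)) * F) :=
        Finset.sum_le_sum fun z _ => hterm z
    _ = (∑ z, |r z| * Real.exp (δ * dist z / n)) * (Real.exp (-(δ * Dd / n)) * F) := by rw [Finset.sum_mul]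
    _ ≤ c * (Real.exp (-(δ * Dd / n)) * F) := mul_le_mul_of_nonneg_right hrow (by positivity)
    _ = c * Real.exp (-(δ * Dd / n)) * F := by ring

/-- the exponent bookkeeping: `e^{−δD/L^i} = e^{δ}·e^{−(δ/(d+1))·dist}` for `D = L^i(dist/(d+1) − 1)`. (verbatim private copy from `…B6DualHolderTermMultiLevelBox`) [folklore] -/
private theorem exp_Dd_eq {δ n dist : ℝ} (hn : 0 < n) (d : ℕ) :
    Real.exp (-(δ * (n * (dist / (d + 1) - 1)) / n)) = Real.exp δ * Real.exp (-(δ / (d + 1) * dist)) := by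
  rw [← Real.exp_add]
  congr 1
  field_simp
  ring

/-- the weakening of a rate against a non-negative distance. (verbatim private copy from `…B6DualHolderTermMultiLevelBox`) [folklore] -/
private theorem exp_rate_mono {δ δ' dist : ℝ} (hδ : δ' ≤ δ) (hdist : 0 ≤ dist) (d : ℕ) :
    Real.exp (-(δ / (d + 1) * dist)) ≤ Real.exp (-(δ' / (d + 1) * dist)) := by
  rw [Real.exp_le_exp, neg_le_neg_iff]
  exact mul_le_mul_of_nonneg_right (div_le_div_of_nonneg_right hδ (by positivity)) hdist

/-- the two exponent steps: `e^{−δD/n} ≤ e^{2δ}·e^{−(δ′/(d+1))dist}`. (verbatim private copy from `…B6DualHolderTermMultiLevelBox`) [folklore] -/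
private theorem exp_Dd_le {δ δ' n dist : ℝ} (hδ : 0 ≤ δ) (hδ' : δ' ≤ δ) (hn : 1 ≤ n) (hdist : 0 ≤ dist) (d : ℕ) :
    Real.exp (-(δ * (n * (dist / (d + 1) - 1)) / n))
      ≤ Real.exp δ * Real.exp δ * Real.exp (-(δ' / (d + 1) * dist)) := by
  have hn0 : 0 < n := by linarith
  rw [exp_Dd_eq hn0 d, mul_assoc]
  have h1 : (1 : ℝ) ≤ Real.exp δ := Real.one_le_exp hδ
  calc Real.exp δ * Real.exp (-(δ / (d + 1) * dist))
      ≤ Real.exp δ * Real.exp (-(δ' / (d + 1) * dist)) :=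
        mul_le_mul_of_nonneg_left (exp_rate_mono hδ' hdist d) (Real.exp_pos _).le
    _ = 1 * (Real.exp δ * Real.exp (-(δ' / (d + 1) * dist))) := (one_mul _).symm
    _ ≤ Real.exp δ * (Real.exp δ * Real.exp (-(δ' / (d + 1) * dist))) :=
        mul_le_mul_of_nonneg_right h1 (by positivity)

/-- the weighted functional is monotone in the rate. (verbatim private copy from `…B6DualHolderTermMultiLevelBox`) [folklore] -/
private theorem wsum_mono_rate {N : Fin (d + 1) → ℕ} {δ δ' : ℝ} (h : δ ≤ δ') (n : ℕ) (x : ↥(boxDom N))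
    (g : ↥(boxDom N) → ℝ) : wsum δ n x g ≤ wsum δ' n x g := by
  unfold wsum
  refine Finset.sum_le_sum fun z _ => mul_le_mul_of_nonneg_left ?_ (abs_nonneg _)
  rw [Real.exp_le_exp]
  exact div_le_div_of_nonneg_right (mul_le_mul_of_nonneg_right h (supNorm_nonneg _)) (Nat.cast_nonneg _)

/-- Hölder weights: `s^{−α}·s = s^{1−α} ≤ T^{1−α}` for `0 < s ≤ T`, `α ≤ 1`. (verbatim private copy from `…B6DualHolderTermMultiLevelBox`) [folklore] -/
private theorem rpow_neg_mul_self_le {s T α : ℝ} (hs : 0 < s) (hsT : s ≤ T) (hα : α ≤ 1) :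
    s ^ (-α) * s ≤ T ^ (1 - α) := by
  have e : s ^ (-α) * s = s ^ (1 - α) := by
    rw [show (1 : ℝ) - α = -α + 1 by ring, Real.rpow_add hs, Real.rpow_one]
  rw [e]
  exact Real.rpow_le_rpow hs.le hsT (by linarith)

/-- Hölder weights: `n^{1−α} ≤ T^{1−α}` for `0 ≤ n ≤ T`, `α ≤ 1`. (verbatim private copy from `…B6DualHolderTermMultiLevelBox`) [folklore] -/
private theorem rpow_one_sub_le {n T α : ℝ} (hn : 0 ≤ n) (hnT : n ≤ T) (hα : α ≤ 1) :
    n ^ (1 - α) ≤ T ^ (1 - α) :=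
  Real.rpow_le_rpow hn hnT (by linarith)

/-- Hölder weights: `s^{−α} = n^{−α}·(n/s)^α` (`n, s > 0`). (verbatim private copy from `…B6DualHolderTermMultiLevelBox`) [folklore] -/
private theorem rpow_neg_eq {n s α : ℝ} (hn : 0 < n) (hs : 0 < s) :
    s ^ (-α) = n ^ (-α) * (n / s) ^ α := by
  rw [Real.div_rpow hn.le hs.le, Real.rpow_neg hs.le, Real.rpow_neg hn.le]
  have hnα : n ^ α ≠ 0 := (Real.rpow_pos_of_pos hn α).ne'
  field_simp

/-- Hölder weights, far pairs: `s^{−α}·T ≤ L·T^{1−α}` when `T ≤ L·n`, `n ≤ s`, `0 ≤ α ≤ 1`, `L ≥ 1`, `n, T > 0`.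
(verbatim private copy from `…B6DualHolderTermMultiLevelBox`) [folklore] -/
private theorem rpow_far_le {n s T L α : ℝ} (hn : 0 < n) (hns : n ≤ s) (hT : 0 < T) (hTL : T ≤ L * n)
    (hL : 1 ≤ L) (hα0 : 0 ≤ α) (hα1 : α ≤ 1) : s ^ (-α) * T ≤ L * T ^ (1 - α) := by
  have hL0 : 0 < L := by linarith
  have h1 : s ^ (-α) ≤ n ^ (-α) := Real.rpow_le_rpow_of_nonpos hn hns (by linarith)
  have hTLn : T / L ≤ n := by rw [div_le_iff₀ hL0]; linarith
  have h2 : n ^ (-α) ≤ (T / L) ^ (-α) := Real.rpow_le_rpow_of_nonpos (div_pos hT hL0) hTLn (by linarith)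
  have h3 : (T / L) ^ (-α) = L ^ α * T ^ (-α) := by
    rw [Real.div_rpow hT.le hL0.le, Real.rpow_neg hT.le, Real.rpow_neg hL0.le]
    field_simp
  have h4 : L ^ α ≤ L := B4Thm19ZeroBoxHolder.rpow_le_self_of_one_le hL hα1
  have h5 : T ^ (-α) * T = T ^ (1 - α) := by
    rw [show (1 : ℝ) - α = -α + 1 by ring, Real.rpow_add hT, Real.rpow_one]
  have hTα : 0 ≤ T ^ (-α) := Real.rpow_nonneg hT.le _
  calc s ^ (-α) * T ≤ L ^ α * T ^ (-α) * T := by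
        refine mul_le_mul_of_nonneg_right (h1.trans (h2.trans h3.le)) hT.le
    _ ≤ L * T ^ (-α) * T := by gcongr
    _ = L * T ^ (1 - α) := by rw [mul_assoc, h5]

end Tools

/-- `|−x|_∞ = |x|_∞`. (verbatim private copy from `…B6DualHolderTermMultiLevelBox`) [folklore] -/
private theorem supNorm_neg' (x : Fin (d + 1) → ℤ) : supNorm (-x) = supNorm x := by
  unfold B4ContourShift.supNorm
  congr 1
  funext i
  simp

/-- the sup distance is symmetric. (verbatim private copy from `…B6DualHolderTermMultiLevelBox`) [folklore] -/
private theorem supNorm_sub_comm (x y : Fin (d + 1) → ℤ) : supNorm (x - y) = supNorm (y - x) := by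
  rw [← supNorm_neg', neg_sub]

/-! ## §2 One term of `G′₀ᵀ∂ᵀ` over a pair of rows, rate uniform in `α` -/

section RowPair

variable {ℓ Mh k R : ℕ} {P : Fin (d + 1) → ℕ} {D : Domains d ℓ Mh k P R} {a c : ℕ → ℝ}

set_option maxHeartbeats 1600000 in
/-- **ONE TERM OF `G′₀ᵀ∂ᵀ` OVER A PAIR OF ROWS IN ONE BLOCK, RATE UNIFORM IN `α`** (`_unif` twin of
`…B6DualHolderTermMultiLevelBox.aXt_dd_le`: `∃ δ₅ ∀ α ∃ Q(α)`; statement and proof otherwise verbatim) (the per-term input of the fifth entry of (2.67) for the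
`k`-level operator): uniformly in the lineage, for every `α ∈ [0,1)` there are `δ₅, Q > 0` with
`|x̂−x|_∞^{−α}·|((v_□G′(□)h_□∂ᵀ)λ)(x̂) − ((v_□G′(□)h_□∂ᵀ)λ)(x)| ≤ (L^{j})^{1−α}·Q·e^{−δ₅d(y,y′)/(d+1)}·sup|λ|`
for `x ≠ x̂` in one `j`-block `y` and `λ` supported in the block `y′` — near pairs (`|x̂−x| + 1 ≤ 2L^{i_□}`) by the
product rule `(v_□(x̂) − v_□(x))·core(x̂) + v_□(x)·(core(x̂) − core(x))` (`core_le`, `core_pair_le`,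
`|v_□(x̂) − v_□(x)| ≤ (d+1)D₁|x̂−x|/L^{j_□}`), far pairs by two single rows (`aXt_row_le`) and
`|x̂−x|^{−α}L^{j} ≤ L·(L^{j})^{1−α}`.
[cite: Balaban1984PropagatorsII, Proposition 2.2 (2.67) p.234 (fifth entry), (2.43) p.230; Balaban1983RegularityDecay,
Theorem (1.9) p.573] -/
theorem aXt_dd_le_unif (d ℓ : ℕ) (hℓ : 1 ≤ ℓ) (aminus aplus a2minus a2plus : ℝ) (ha : 0 < aminus) (ha2 : 0 < a2minus) :
    ∃ δ₅ : ℝ, 0 < δ₅ ∧ ∀ (α : ℝ), 0 ≤ α → α < 1 → ∃ Q : ℝ, 0 < Q ∧ ∀ (k Mh R : ℕ), 3 ≤ Mh → 2 * (ℓ + 1) ≤ R →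
      ∀ (P : Fin (d + 1) → ℕ) (hP : ∀ μ, 1 ≤ P μ) (D : Domains d ℓ Mh k P R) (a c : ℕ → ℝ),
        (∀ i, 1 ≤ i → aminus ≤ a i ∧ a i ≤ aplus) → (∀ i, 1 ≤ i → a2minus ≤ c i ∧ c i ≤ a2plus) →
        ∀ (μ : Fin (d + 1)) (y' : ↥(bset D)) (lam : ↥(boxDom (N0 ℓ Mh k P)) → ℝ) (B : ℝ),
          BlockSupp (g := geom D) (blkOf D) lam y' B →
          ∀ (x x' : ↥(boxDom (N0 ℓ Mh k P))), x'.1 ≠ x.1 → blkOf D x' = blkOf D x →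
          ∀ (cq : ℕ × (Fin (d + 1) → ℤ)) (hc : CubeData D cq),
            (supNorm (x'.1 - x.1)) ^ (-α)
                * |((((aX D a c hP cq hc)ᵀ * (dMat (N0 ℓ Mh k P) μ)ᵀ) *ᵥ lam) x'
                    - (((aX D a c hP cq hc)ᵀ * (dMat (N0 ℓ Mh k P) μ)ᵀ) *ᵥ lam) x)|
              ≤ (((ℓ : ℝ) + 1) ^ D.lev x.1) ^ (1 - α)
                * (Q * Real.exp (-(δ₅ / (d + 1) * (geom D).dist (blkOf D x) y')) * B) := by
  obtain ⟨δ'', c', hδ'', hc', h243⟩ := ineq243_twoLevel_roww d ℓ hℓ aminus aplus 0 a2minus a2plus ha ha2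
  obtain ⟨δs, cs, hδs, hcs, h243s⟩ := ineq243_twoLevel_dstar_roww d ℓ hℓ aminus aplus 0 a2minus a2plus ha ha2
  obtain ⟨δd, cd, hδd, hcd, h243d⟩ := ineq243_twoLevel_deriv_wsum d ℓ hℓ aminus aplus 0 a2minus a2plus ha ha2
  obtain ⟨δH, hδH, hHU⟩ := ineq243_twoLevel_holderDual_wsum2_unif d ℓ hℓ aminus aplus 0 a2minus a2plus ha ha2
  have hD1 := D1_nonneg contDiff_hprof hasCompactSupport_hprof
  obtain ⟨δ₅, hδ₅⟩ : ∃ t : ℝ, t = min (min δ'' δs) (min δd δH) := ⟨_, rfl⟩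
  have hδ₅pos : 0 < δ₅ := by rw [hδ₅]; exact lt_min (lt_min hδ'' hδs) (lt_min hδd hδH)
  have h51 : δ₅ ≤ δ'' := by rw [hδ₅]; exact (min_le_left _ _).trans (min_le_left _ _)
  have h52 : δ₅ ≤ δs := by rw [hδ₅]; exact (min_le_left _ _).trans (min_le_right _ _)
  have h53 : δ₅ ≤ δd := by rw [hδ₅]; exact (min_le_right _ _).trans (min_le_left _ _)
  have h54 : δ₅ ≤ δH := by rw [hδ₅]; exact (min_le_right _ _).trans (min_le_right _ _)
  obtain ⟨Q'', hQ''⟩ : ∃ t : ℝ, t = (d + 1) * D1 hprof * c' + cs := ⟨_, rfl⟩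
  have hQ''0 : 0 ≤ Q'' := by rw [hQ'']; have := hc'.le; have := hcs.le; positivity
  obtain ⟨EE, hEE⟩ : ∃ t : ℝ, t = Real.exp δ₅ * Real.exp δ₅ := ⟨_, rfl⟩
  have hEE1 : 1 ≤ EE := by
    rw [hEE]; have h1 : (1 : ℝ) ≤ Real.exp δ₅ := Real.one_le_exp hδ₅pos.le; nlinarith
  have hEE0 : 0 ≤ EE := zero_le_one.trans hEE1
  refine ⟨δ₅, hδ₅pos, fun α hα0 hα1 => ?_⟩
  obtain ⟨cH, hcH, hH⟩ := hHU α hα0 hα1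
  obtain ⟨Qp, hQp⟩ : ∃ t : ℝ, t = ((d + 1) * ((d + 1) * D1 hprof) * EE * cd + cH) * EE := ⟨_, rfl⟩
  have hQp0 : 0 ≤ Qp := by rw [hQp]; have := hcd.le; have := hcH.le; positivity
  refine ⟨(d + 1) * D1 hprof * (Q'' * EE) + Qp + 2 * ((ℓ : ℝ) + 1) * (Q'' * EE) + 1, by positivity, ?_⟩
  intro k Mh R hMh hR P hP D a c haw hcw μ y' lam B hlam x x' hne hblk cq hc
  obtain ⟨hi1, hij, hji, -, -⟩ := fin_data hc
  have hjk := hc.hj.2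
  have hMh1 : 1 ≤ Mh := le_trans (by norm_num) hMh
  have hL1 : (1 : ℝ) ≤ (ℓ : ℝ) + 1 := by linarith [(Nat.cast_nonneg ℓ : (0 : ℝ) ≤ ℓ)]
  have hB0 : 0 ≤ B := hlam.nonneg
  have hlamB : ∀ w, |lam w| ≤ B := fun w => BlockSupp.abs_le hlam w
  obtain ⟨dist0, hdist0⟩ : ∃ t : ℝ, t = (((bond D).dist (blkOf D x) y' : ℕ) : ℝ) := ⟨_, rfl⟩
  have hgeom : (geom D).dist (blkOf D x) y' = dist0 := by rw [hdist0]; rfl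
  have hgeom' : (geom D).dist (blkOf D x') y' = dist0 := by rw [hblk, hgeom]
  have hdist0nn : 0 ≤ dist0 := by rw [hdist0]; positivity
  rw [hgeom]
  obtain ⟨E5, hE5⟩ : ∃ t : ℝ, t = Real.exp (-(δ₅ / (d + 1) * dist0)) := ⟨_, rfl⟩
  rw [← hE5]
  have hE50 : 0 ≤ E5 := by rw [hE5]; exact (Real.exp_pos _).le
  obtain ⟨LJ, hLJ⟩ : ∃ t : ℝ, t = ((ℓ : ℝ) + 1) ^ D.lev x.1 := ⟨_, rfl⟩
  rw [← hLJ]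
  have hLJ0 : 0 < LJ := by rw [hLJ]; positivity
  have hLJα0 : 0 ≤ LJ ^ (1 - α) := Real.rpow_nonneg hLJ0.le _
  have hRHS0 : 0 ≤ LJ ^ (1 - α)
      * (((d + 1) * D1 hprof * (Q'' * EE) + Qp + 2 * ((ℓ : ℝ) + 1) * (Q'' * EE) + 1) * E5 * B) := by positivity
  obtain ⟨s, hs⟩ : ∃ t : ℝ, t = supNorm (x'.1 - x.1) := ⟨_, rfl⟩
  have hs1 : 1 ≤ s := by rw [hs]; exact B4StripSumsHolder.one_le_supNorm (sub_ne_zero.2 hne)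
  have hs0 : 0 < s := lt_of_lt_of_le one_pos hs1
  rw [← hs]
  have hW0 : 0 ≤ s ^ (-α) := Real.rpow_nonneg hs0.le _
  -- the trivial case: `h_□` vanishes at both points
  by_cases h0 : uX (ℓ := ℓ) (Mh := Mh) (k := k) (P := P) cq x = 0 ∧ uX (ℓ := ℓ) (Mh := Mh) (k := k) (P := P) cq x' = 0
  · rw [aXt_dMatt_mulVec hP cq hc μ lam x, aXt_dMatt_mulVec hP cq hc μ lam x', vX_eq_zero_of_uX cq h0.1,
      vX_eq_zero_of_uX cq h0.2]
    simp only [zero_mul, sub_self, abs_zero, mul_zero]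
    exact hRHS0
  have hu : uX (ℓ := ℓ) (Mh := Mh) (k := k) (P := P) cq x ≠ 0 ∨ uX (ℓ := ℓ) (Mh := Mh) (k := k) (P := P) cq x' ≠ 0 := by
    by_contra h'; push Not at h'; exact h0 ⟨h'.1, h'.2⟩
  -- the level window at `x`
  have hlevx' : D.lev x'.1 = D.lev x.1 := congrArg (fun s : ↥(bset D) => s.1.1) hblk
  have hzval : ∀ w : ↥(boxDom (N0 ℓ Mh k P)), ((castP (ℓ := ℓ) (Mh := Mh) (P := P) hij hjk).symm w).1 = w.1 :=
    fun w => by unfold castP; exact boxCast_symm_apply_val _ _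
  have hinc : ∀ (w : ↥(boxDom (N0 ℓ Mh k P))) (bw : ↥(Box d ℓ (fin D cq.1 cq.2)
      (fun ν => (ℓ + 1) * cubeM' (MhP ℓ Mh cq.1 (fin D cq.1 cq.2)) (Pj ℓ k P cq.1) cq.2 ν))),
      embC D hP cq hc bw = (castP (ℓ := ℓ) (Mh := Mh) (P := P) hij hjk).symm w → InCube ℓ Mh k P cq.1 cq.2 w.1 :=
    fun w bw hbw => by rw [← hzval w]; exact (inCube_iff_exists_emb (Mh := Mh) hP hij hc.hq _).2 ⟨bw, hbw⟩
  have hwin : fin D cq.1 cq.2 ≤ D.lev x.1 ∧ D.lev x.1 ≤ fin D cq.1 cq.2 + 1 := by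
    rcases hu with h | h
    · obtain ⟨bw, hbw⟩ := img_of_uX_ne_zero hℓ hP hMh1 cq hc h (Or.inr rfl)
      exact lev_window_of_inCube hℓ hR hP hMh1 hc x.2 (hinc x bw hbw)
    · obtain ⟨bw, hbw⟩ := img_of_uX_ne_zero hℓ hP hMh1 cq hc h (Or.inr rfl)
      rw [← hlevx']; exact lev_window_of_inCube hℓ hR hP hMh1 hc x'.2 (hinc x' bw hbw)
  obtain ⟨nn, hnn⟩ : ∃ t : ℝ, t = (((ℓ + 1) ^ fin D cq.1 cq.2 : ℕ) : ℝ) := ⟨_, rfl⟩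
  have hncast : nn = ((ℓ : ℝ) + 1) ^ fin D cq.1 cq.2 := by rw [hnn]; push_cast; ring
  have hn1' : 1 ≤ (ℓ + 1) ^ fin D cq.1 cq.2 := Nat.one_le_pow _ _ (by omega)
  have hn1 : (1 : ℝ) ≤ nn := by rw [hnn]; exact_mod_cast hn1'
  have hn0 : (0 : ℝ) < nn := lt_of_lt_of_le one_pos hn1
  have hnLJ : nn ≤ LJ := by rw [hncast, hLJ]; exact pow_le_pow_right₀ hL1 hwin.1
  have hT : LJ ≤ ((ℓ : ℝ) + 1) * nn := by
    rw [hLJ, hncast, ← pow_succ']; exact pow_le_pow_right₀ hL1 hwin.2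
  obtain ⟨Nj, hNj⟩ : ∃ t : ℝ, t = (((ℓ + 1) ^ cq.1 : ℕ) : ℝ) := ⟨_, rfl⟩
  have hNj1' : 1 ≤ (ℓ + 1) ^ cq.1 := Nat.one_le_pow _ _ (by omega)
  have hNj0 : 0 < Nj := by rw [hNj]; exact_mod_cast hNj1'
  have hnNj : nn ≤ Nj := by
    rw [hnn, hNj]; exact_mod_cast Nat.pow_le_pow_right (by omega) hij
  have hM1 : 1 ≤ (ℓ + 1) * Mh := Nat.one_le_iff_ne_zero.2 (Nat.mul_ne_zero_iff.2 ⟨by omega, by omega⟩)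
  -- the per-cube inputs
  have hcM' : ∀ ν, 1 ≤ cubeM' (MhP ℓ Mh cq.1 (fin D cq.1 cq.2)) (Pj ℓ k P cq.1) cq.2 ν := fun ν =>
    Nat.one_le_iff_ne_zero.2 (Nat.mul_ne_zero_iff.2
      ⟨by have := one_le_MhP (ℓ := ℓ) hMh1 cq.1 (fin D cq.1 cq.2); omega,
        by have := (one_le_cubeW (one_le_Pj hP cq.1) hc.hq ν).1; omega⟩)
  have h243c : ∀ b, roww δ'' ((ℓ + 1) ^ fin D cq.1 cq.2) (cG D a c cq.1 (fin D cq.1 cq.2) cq.2 hP hc.hq) b ≤ c' :=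
    fun b => h243 (fin D cq.1 cq.2) hi1 (a (fin D cq.1 cq.2)) 0 (c (fin D cq.1 cq.2)) (haw _ hi1).1 (haw _ hi1).2
      le_rfl le_rfl (hcw _ hi1).1 (hcw _ hi1).2 _ hcM' _ b
  have h243sc : ∀ b, roww δs ((ℓ + 1) ^ fin D cq.1 cq.2)
      (dstar ((ℓ + 1) ^ fin D cq.1 cq.2) μ (cG D a c cq.1 (fin D cq.1 cq.2) cq.2 hP hc.hq)) b ≤ cs :=
    fun b => h243s (fin D cq.1 cq.2) hi1 (a (fin D cq.1 cq.2)) 0 (c (fin D cq.1 cq.2)) (haw _ hi1).1 (haw _ hi1).2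
      le_rfl le_rfl (hcw _ hi1).1 (hcw _ hi1).2 _ hcM'
      (lamLoc ℓ (MhP ℓ Mh cq.1 (fin D cq.1 cq.2)) (Pj ℓ k P cq.1) cq.2 (one_le_Pj hP cq.1) hc.hq
        (LamG D cq.1 (fin D cq.1 cq.2))) μ b
  have hrow := aXt_row_le (a := a) (c := c) hℓ hR hP hMh1 cq hc μ hδ₅pos.le h51 h52 hc'.le hcs.le h243c h243sc
    y' lam B hlam
  have hrowx := hrow x
  have hrowx' := hrow x'
  rw [hgeom, ← hE5, ← hnn, ← hQ'', ← hEE] at hrowx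
  rw [hgeom', ← hE5, ← hnn, ← hQ'', ← hEE] at hrowx'
  by_cases hnear : s + 1 ≤ 2 * nn
  · -- NEAR PAIRS: both points lie in the cube image
    obtain ⟨b, b', hb, hb'⟩ : ∃ b b', embC D hP cq hc b = (castP (ℓ := ℓ) (Mh := Mh) (P := P) hij hjk).symm x
        ∧ embC D hP cq hc b' = (castP (ℓ := ℓ) (Mh := Mh) (P := P) hij hjk).symm x' := by
      have hd1 : supNorm (x'.1 - x.1) ≤ 2 * (((ℓ + 1) ^ fin D cq.1 cq.2 : ℕ) : ℝ) := by
        rw [← hs, ← hnn]; linarith only [hnear]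
      have hd2 : supNorm (x.1 - x'.1) ≤ 2 * (((ℓ + 1) ^ fin D cq.1 cq.2 : ℕ) : ℝ) := by
        rw [supNorm_sub_comm]; exact hd1
      have hd0 : ∀ w : ↥(boxDom (N0 ℓ Mh k P)), supNorm (w.1 - w.1) ≤ 2 * (((ℓ + 1) ^ fin D cq.1 cq.2 : ℕ) : ℝ) := by
        intro w
        have h0 : supNorm (w.1 - w.1) = 0 := by rw [sub_self]; unfold B4ContourShift.supNorm; simp
        rw [h0]; positivity
      rcases hu with h | h
      · obtain ⟨b, hb⟩ := img_of_near hℓ hP hMh cq hc h (hd0 x)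
        obtain ⟨b', hb'⟩ := img_of_near hℓ hP hMh cq hc h hd1
        exact ⟨b, b', hb, hb'⟩
      · obtain ⟨b, hb⟩ := img_of_near hℓ hP hMh cq hc h hd2
        obtain ⟨b', hb'⟩ := img_of_near hℓ hP hMh cq hc h (hd0 x')
        exact ⟨b, b', hb, hb'⟩
    have hbx : (embC D hP cq hc b).1 = x.1 := by rw [hb, hzval]
    have hb'x : (embC D hP cq hc b').1 = x'.1 := by rw [hb', hzval]
    have hsubE : ∀ u v, (embC D hP cq hc u).1 - (embC D hP cq hc v).1 = u.1 - v.1 := fun u v => by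
      unfold embC; exact emb_sub_emb _ hc.hq u v
    have hb'b : b'.1 - b.1 = x'.1 - x.1 := by rw [← hsubE b' b, hb'x, hbx]
    have hsb : supNorm (b'.1 - b.1) = s := by rw [hb'b, hs]
    have hneb : b'.1 ≠ b.1 := fun h => hne (by
      have := hb'b; rw [h, sub_self] at this; exact (sub_eq_zero.1 this.symm))
    have hxin : InCube ℓ Mh k P cq.1 cq.2 x.1 := hinc x b hb
    have hx'in : InCube ℓ Mh k P cq.1 cq.2 x'.1 := hinc x' b' hb'
    -- support distances of `λ` read on the cube, from `x` and from `x̂`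
    obtain ⟨Dd, hDd⟩ : ∃ t : ℝ, t = nn * (dist0 / (d + 1) - 1) := ⟨_, rfl⟩
    have hDgen : ∀ (w : ↥(boxDom (N0 ℓ Mh k P))) (bw : ↥(Box d ℓ (fin D cq.1 cq.2)
        (fun ν => (ℓ + 1) * cubeM' (MhP ℓ Mh cq.1 (fin D cq.1 cq.2)) (Pj ℓ k P cq.1) cq.2 ν))),
        (embC D hP cq hc bw).1 = w.1 → InCube ℓ Mh k P cq.1 cq.2 w.1 → (geom D).dist (blkOf D w) y' = dist0 →
        ∀ z, lam (castP (fin_data hc).2.1 hc.hj.2 (embC D hP cq hc z)) ≠ 0 → Dd ≤ supNorm (bw.1 - z.1) := by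
      intro w bw hbw hwin' hwd z hz
      set x'' : ↥(boxDom (N0 ℓ Mh k P)) := castP (fin_data hc).2.1 hc.hj.2 (embC D hP cq hc z) with hx''
      have hx''val : x''.1 = (embC D hP cq hc z).1 := by
        rw [hx'']; unfold castP; exact boxCast_apply_val _ _
      have hx''in : InCube ℓ Mh k P cq.1 cq.2 x''.1 := by
        rw [hx''val]
        exact (inCube_iff_exists_emb (Mh := Mh) hP hij hc.hq _).2 ⟨z, rfl⟩
      have hblk'' : blkOf D x'' = y' := by
        by_contra hne'
        exact hz (hlam.off x'' hne')
      have h := Dd_le_supNorm hℓ hR hP hMh1 hc w x'' hwin' hx''in y' hblk''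
      have hsub : w.1 - x''.1 = bw.1 - z.1 := by rw [hx''val, ← hbw]; exact hsubE bw z
      rw [hsub] at h
      have hd' : (((bond D).dist (blkOf D w) y' : ℕ) : ℝ) = dist0 := hwd
      rw [hd', ← hnn, ← hDd] at h
      exact h
    have hD_b := hDgen x b hbx hxin hgeom
    have hD_b' := hDgen x' b' hb'x hx'in hgeom'
    have hexp : Real.exp (-(δ₅ * Dd / nn)) ≤ EE * E5 := by
      rw [hDd, hEE, hE5]; exact exp_Dd_le hδ₅pos.le le_rfl hn1 hdist0nn d
    -- the core at `x̂` and the core pair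
    have hcore' := core_le (a := a) (c := c) hℓ hP hMh1 cq hc μ hδ₅pos.le h51 h52 h243c h243sc lam hB0
      (fun z => hlamB _) hb' hD_b'
    rw [← hnn, ← hQ''] at hcore'
    have hpair := core_pair_le (a := a) (c := c) hℓ hP hMh1 cq hc μ (α := α) hδ₅pos.le h53 h54 hcd.le
      (fun i u ue hue => h243d (fin D cq.1 cq.2) hi1 (a (fin D cq.1 cq.2)) 0 (c (fin D cq.1 cq.2)) (haw _ hi1).1
        (haw _ hi1).2 le_rfl le_rfl (hcw _ hi1).1 (hcw _ hi1).2 _ hcM' _ i u ue hue)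
      (fun u u' hne' => hH (fin D cq.1 cq.2) hi1 (a (fin D cq.1 cq.2)) 0 (c (fin D cq.1 cq.2))
        (haw _ hi1).1 (haw _ hi1).2 le_rfl le_rfl (hcw _ hi1).1 (hcw _ hi1).2 _ hcM' _ μ u u' hne')
      lam hB0 (fun z => hlamB _) hb hb' hneb (by rw [hsb, ← hnn]; exact hnear) hD_b hD_b'
    rw [hsb, ← hnn, ← hNj, ← hEE] at hpair
    -- the cut-off difference
    have hdv : |vX D cq x' - vX D cq x| ≤ (d + 1) * D1 hprof * s / Nj := by
      refine (abs_vX_sub_le (D := D) cq hlevx').trans ?_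
      have h := abs_hq_sub_le (d := d) hNj1' hM1 cq.2 x.1 x'.1
      rw [← hNj, ← hs] at h
      refine h.trans (div_le_div_of_nonneg_right ?_ hNj0.le)
      have hMr : (1 : ℝ) ≤ (((ℓ + 1) * Mh : ℕ) : ℝ) := by exact_mod_cast hM1
      exact mul_le_mul_of_nonneg_right (div_le_self (by positivity) hMr) hs0.le
    have hvx : |vX D cq x| ≤ 1 := abs_vX_le_one cq x
    -- the Hölder weights
    have hWs : s ^ (-α) * s ≤ LJ ^ (1 - α) := by
      refine rpow_neg_mul_self_le hs0 ?_ hα1.le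
      have h := supNorm_le_of_blkOf_eq (D := D) hblk
      have e : (((ℓ + 1) ^ D.lev x.1 : ℕ) : ℝ) = LJ := by rw [hLJ]; push_cast; ring
      rw [← hs, e] at h
      exact h.trans (sub_le_self _ zero_le_one)
    have hnα : nn ^ (1 - α) ≤ LJ ^ (1 - α) := rpow_one_sub_le hn0.le hnLJ hα1.le
    have hnNj' : nn / Nj ≤ 1 := by rw [div_le_one hNj0]; exact hnNj
    -- the product rule
    rw [aXt_dMatt_mulVec hP cq hc μ lam x, aXt_dMatt_mulVec hP cq hc μ lam x']
    obtain ⟨Cx, hCx⟩ : ∃ t : ℝ, t = ∑ z, colKer D a c hP cq hc μ x z * lam z := ⟨_, rfl⟩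
    obtain ⟨Cx', hCx'⟩ : ∃ t : ℝ, t = ∑ z, colKer D a c hP cq hc μ x' z * lam z := ⟨_, rfl⟩
    have hdiffC : ∑ z, (colKer D a c hP cq hc μ x' z - colKer D a c hP cq hc μ x z) * lam z = Cx' - Cx := by
      rw [hCx, hCx', ← Finset.sum_sub_distrib]; exact Finset.sum_congr rfl fun z _ => by ring
    rw [hdiffC] at hpair
    rw [← hCx'] at hcore'
    rw [← hCx, ← hCx']
    have e1 : s ^ (-α) * |vX D cq x' * Cx' - vX D cq x * Cx|
        = |s ^ (-α) * (vX D cq x' - vX D cq x) * Cx' + vX D cq x * (s ^ (-α) * (Cx' - Cx))| := by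
      rw [← abs_of_nonneg hW0, ← abs_mul, abs_of_nonneg hW0]; ring_nf
    rw [e1]
    have hA : |s ^ (-α) * (vX D cq x' - vX D cq x) * Cx'|
        ≤ (d + 1) * D1 hprof * (Q'' * EE) * (LJ ^ (1 - α) * (E5 * B)) := by
      rw [abs_mul, abs_mul, abs_of_nonneg hW0]
      calc s ^ (-α) * |vX D cq x' - vX D cq x| * |Cx'|
          ≤ s ^ (-α) * ((d + 1) * D1 hprof * s / Nj) * (nn * Q'' * Real.exp (-(δ₅ * Dd / nn)) * B) :=
            mul_le_mul (mul_le_mul_of_nonneg_left hdv hW0) hcore' (abs_nonneg _) (by positivity)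
        _ = (d + 1) * D1 hprof * Q'' * ((s ^ (-α) * s) * (nn / Nj)) * (Real.exp (-(δ₅ * Dd / nn)) * B) := by
            field_simp
        _ ≤ (d + 1) * D1 hprof * Q'' * (LJ ^ (1 - α) * 1) * ((EE * E5) * B) := by
            refine mul_le_mul (mul_le_mul_of_nonneg_left (mul_le_mul hWs hnNj' (by positivity) hLJα0)
              (by positivity)) (mul_le_mul_of_nonneg_right hexp hB0) (by positivity) (by positivity)
        _ = (d + 1) * D1 hprof * (Q'' * EE) * (LJ ^ (1 - α) * (E5 * B)) := by ring
    have hBterm : |vX D cq x * (s ^ (-α) * (Cx' - Cx))| ≤ Qp * (LJ ^ (1 - α) * (E5 * B)) := by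
      rw [abs_mul]
      have hp' : |s ^ (-α) * (Cx' - Cx)|
          ≤ ((d + 1) * ((d + 1) * D1 hprof) * EE * cd * (s ^ (-α) * s) * (nn / Nj) + nn ^ (1 - α) * cH)
            * Real.exp (-(δ₅ * Dd / nn)) * B := by
        rw [abs_mul, abs_of_nonneg hW0]; exact hpair
      have hcd0 := hcd.le
      have hcH0 := hcH.le
      calc |vX D cq x| * |s ^ (-α) * (Cx' - Cx)|
          ≤ 1 * (((d + 1) * ((d + 1) * D1 hprof) * EE * cd * (s ^ (-α) * s) * (nn / Nj) + nn ^ (1 - α) * cH)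
              * Real.exp (-(δ₅ * Dd / nn)) * B) := mul_le_mul hvx hp' (abs_nonneg _) zero_le_one
        _ ≤ 1 * (((d + 1) * ((d + 1) * D1 hprof) * EE * cd * (LJ ^ (1 - α) * 1) + LJ ^ (1 - α) * cH)
              * (EE * E5) * B) := by
            refine mul_le_mul_of_nonneg_left ?_ zero_le_one
            have hC0 : 0 ≤ (d + 1) * ((d + 1) * D1 hprof) * EE * cd := by positivity
            have h1 : (d + 1) * ((d + 1) * D1 hprof) * EE * cd * (s ^ (-α) * s) * (nn / Nj)
                ≤ (d + 1) * ((d + 1) * D1 hprof) * EE * cd * (LJ ^ (1 - α) * 1) := by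
              rw [mul_assoc ((d + 1) * ((d + 1) * D1 hprof) * EE * cd)]
              exact mul_le_mul_of_nonneg_left (mul_le_mul hWs hnNj' (by positivity) hLJα0) hC0
            refine mul_le_mul (mul_le_mul (add_le_add h1 (mul_le_mul_of_nonneg_right hnα hcH0)) hexp
              (by positivity) (by positivity)) le_rfl hB0 (by positivity)
        _ = Qp * (LJ ^ (1 - α) * (E5 * B)) := by rw [hQp]; ring
    calc |s ^ (-α) * (vX D cq x' - vX D cq x) * Cx' + vX D cq x * (s ^ (-α) * (Cx' - Cx))|
        ≤ (d + 1) * D1 hprof * (Q'' * EE) * (LJ ^ (1 - α) * (E5 * B)) + Qp * (LJ ^ (1 - α) * (E5 * B)) :=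
          (abs_add_le _ _).trans (add_le_add hA hBterm)
      _ = LJ ^ (1 - α) * (((d + 1) * D1 hprof * (Q'' * EE) + Qp) * E5 * B) := by ring
      _ ≤ LJ ^ (1 - α)
          * (((d + 1) * D1 hprof * (Q'' * EE) + Qp + 2 * ((ℓ : ℝ) + 1) * (Q'' * EE) + 1) * E5 * B) := by
          refine mul_le_mul_of_nonneg_left (mul_le_mul_of_nonneg_right (mul_le_mul_of_nonneg_right ?_ hE50) hB0)
            hLJα0
          have : 0 ≤ 2 * ((ℓ : ℝ) + 1) * (Q'' * EE) := by positivity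
          linarith
  · -- FAR PAIRS: two single rows
    have hns : nn ≤ s := by push Not at hnear; linarith
    have hWL : s ^ (-α) * LJ ≤ ((ℓ : ℝ) + 1) * LJ ^ (1 - α) := rpow_far_le hn0 hns hLJ0 hT hL1 hα0 hα1.le
    have hWn : s ^ (-α) * nn ≤ ((ℓ : ℝ) + 1) * LJ ^ (1 - α) := (mul_le_mul_of_nonneg_left hnLJ hW0).trans hWL
    calc s ^ (-α) * |(((aX D a c hP cq hc)ᵀ * (dMat (N0 ℓ Mh k P) μ)ᵀ) *ᵥ lam) x'
            - (((aX D a c hP cq hc)ᵀ * (dMat (N0 ℓ Mh k P) μ)ᵀ) *ᵥ lam) x|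
        ≤ s ^ (-α) * (nn * Q'' * EE * E5 * B + nn * Q'' * EE * E5 * B) :=
          mul_le_mul_of_nonneg_left ((abs_sub _ _).trans (add_le_add hrowx' hrowx)) hW0
      _ = (s ^ (-α) * nn) * (2 * (Q'' * EE) * E5 * B) := by ring
      _ ≤ (((ℓ : ℝ) + 1) * LJ ^ (1 - α)) * (2 * (Q'' * EE) * E5 * B) :=
          mul_le_mul_of_nonneg_right hWn (by positivity)
      _ = LJ ^ (1 - α) * ((2 * ((ℓ : ℝ) + 1) * (Q'' * EE)) * E5 * B) := by ring
      _ ≤ LJ ^ (1 - α)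
          * (((d + 1) * D1 hprof * (Q'' * EE) + Qp + 2 * ((ℓ : ℝ) + 1) * (Q'' * EE) + 1) * E5 * B) := by
          refine mul_le_mul_of_nonneg_left (mul_le_mul_of_nonneg_right (mul_le_mul_of_nonneg_right ?_ hE50) hB0)
            hLJα0
          have : 0 ≤ (d + 1) * D1 hprof * (Q'' * EE) := by positivity
          linarith

end RowPair

/-! ## §3 One term of `Rᵀ` over a pair of columns, rate uniform in `α` -/

section ColPair

variable {ℓ Mh k R : ℕ} {P : Fin (d + 1) → ℕ} {D : Domains d ℓ Mh k P R} {a c : ℕ → ℝ}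

set_option maxHeartbeats 1600000 in
/-- (`_unif` twin of `…B6DualHolderTermMultiLevelBox.bXt_dd_le`: `∃ δ₆ ∀ α ∃ Q(α)`; statement and proof otherwise verbatim.)
**ONE TERM OF `Rᵀ` ON THE LEVEL-WEIGHTED INPUT OVER A PAIR OF COLUMNS IN ONE BLOCK** (the per-term smallness
input of the fifth entry of (2.67) for the `k`-level operator): uniformly in the lineage, for every `α ∈ [0,1)` there
are `δ₆, Q > 0` with
`|x̂−x|_∞^{−α}·|((K_□(h_□)G′(□)v_□)ᵀ(Λf))(x̂) − (…)(x)| ≤ (L^{j})^{1−α}·(Q/M_h)·e^{−δ₆d(y,y′)/(d+1)}·sup|f|`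
for `x ≠ x̂` in one `j`-block `y` and `f` supported in the block `y′` — near pairs (`|x̂−x| ≤ L^{i_□}`) by
`bXt_pair_near_le` with `κ, κ₁ = O(M^{−1})`, `κ₂ = O(M^{−2})` and `(L^{i})^{−α}L^{j+1} ≤ L²(L^{j})^{1−α}`; far pairs by two
single columns (`bXt_col_le`) and `|x̂−x|^{−α}L^{j+1} ≤ L²(L^{j})^{1−α}`.
[cite: Balaban1984PropagatorsII, Proposition 2.2 (2.67) p.234 (fifth entry), (2.44) p.230, (2.49)/(2.51) p.232;
Balaban1983RegularityDecay, Theorem (1.9) p.573] -/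
theorem bXt_dd_le_unif (d ℓ : ℕ) (hℓ : 1 ≤ ℓ) (aminus aplus a2minus a2plus : ℝ) (ha : 0 < aminus) (ha2 : 0 < a2minus) :
    ∃ δ₆ : ℝ, 0 < δ₆ ∧ ∀ (α : ℝ), 0 ≤ α → α < 1 → ∃ Q : ℝ, 0 < Q ∧ ∀ (k Mh R : ℕ), 3 ≤ Mh → 2 * (ℓ + 1) ≤ R →
      ∀ (P : Fin (d + 1) → ℕ) (hP : ∀ μ, 1 ≤ P μ) (D : Domains d ℓ Mh k P R) (a c : ℕ → ℝ),
        (∀ i, 1 ≤ i → aminus ≤ a i ∧ a i ≤ aplus) → (∀ i, 1 ≤ i → a2minus ≤ c i ∧ c i ≤ a2plus) →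
        ∀ (y' : ↥(bset D)) (f : ↥(boxDom (N0 ℓ Mh k P)) → ℝ) (B : ℝ),
          BlockSupp (g := geom D) (blkOf D) f y' B →
          ∀ (x x' : ↥(boxDom (N0 ℓ Mh k P))), x'.1 ≠ x.1 → blkOf D x' = blkOf D x →
          ∀ (cq : ℕ × (Fin (d + 1) → ℤ)) (hc : CubeData D cq),
            (supNorm (x'.1 - x.1)) ^ (-α)
                * |((bX D a c hP cq hc)ᵀ *ᵥ (levW D 1 *ᵥ f)) x' - ((bX D a c hP cq hc)ᵀ *ᵥ (levW D 1 *ᵥ f)) x|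
              ≤ (((ℓ : ℝ) + 1) ^ D.lev x.1) ^ (1 - α)
                * (Q / Mh * Real.exp (-(δ₆ / (d + 1) * (geom D).dist (blkOf D x) y')) * B) := by
  obtain ⟨δa, c', hδa, hc', h243⟩ := ineq243_twoLevel_roww d ℓ hℓ aminus aplus 0 a2minus a2plus ha ha2
  obtain ⟨δs, cs, hδs, hcs, h243s⟩ := ineq243_twoLevel_dstar_roww d ℓ hℓ aminus aplus 0 a2minus a2plus ha ha2
  obtain ⟨δd, cd, hδd, hcd, h243d⟩ := ineq243_twoLevel_deriv_wsum d ℓ hℓ aminus aplus 0 a2minus a2plus ha ha2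
  obtain ⟨δH, hδH, hHU⟩ := ineq243_twoLevel_holderDual_wsum2_unif d ℓ hℓ aminus aplus 0 a2minus a2plus ha ha2
  obtain ⟨δ₇, K₇, hδ₇, hK₇, hcol⟩ := bXt_col_le d ℓ hℓ aminus aplus a2minus a2plus ha ha2
  have hD1 := D1_nonneg contDiff_hprof hasCompactSupport_hprof
  have hD2 := D2_nonneg contDiff_hprof hasCompactSupport_hprof
  obtain ⟨δ, hδdef⟩ : ∃ t : ℝ, t = min (min δa δs) (min δd δH) := ⟨_, rfl⟩
  have hδpos : 0 < δ := by rw [hδdef]; exact lt_min (lt_min hδa hδs) (lt_min hδd hδH)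
  have h1a : δ ≤ δa := by rw [hδdef]; exact (min_le_left _ _).trans (min_le_left _ _)
  have h1s : δ ≤ δs := by rw [hδdef]; exact (min_le_left _ _).trans (min_le_right _ _)
  have h1d : δ ≤ δd := by rw [hδdef]; exact (min_le_right _ _).trans (min_le_left _ _)
  have h1H : δ ≤ δH := by rw [hδdef]; exact (min_le_right _ _).trans (min_le_right _ _)
  obtain ⟨δ₆, hδ₆⟩ : ∃ t : ℝ, t = min δ δ₇ := ⟨_, rfl⟩
  have hδ₆pos : 0 < δ₆ := by rw [hδ₆]; exact lt_min hδpos hδ₇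
  have h6δ : δ₆ ≤ δ := by rw [hδ₆]; exact min_le_left _ _
  have h67 : δ₆ ≤ δ₇ := by rw [hδ₆]; exact min_le_right _ _
  have hL0 : (0 : ℝ) < (ℓ : ℝ) + 1 := by positivity
  have hL1 : (1 : ℝ) ≤ (ℓ : ℝ) + 1 := by linarith [(Nat.cast_nonneg ℓ : (0 : ℝ) ≤ ℓ)]
  refine ⟨δ₆, hδ₆pos, fun α hα0 hα1 => ?_⟩
  obtain ⟨cH, hcH, hH⟩ := hHU α hα0 hα1
  -- the `M`-free constants
  obtain ⟨A₁, hA₁⟩ : ∃ A₁ : ℝ, A₁ = (d + 1) * D1 hprof := ⟨_, rfl⟩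
  obtain ⟨A₂, hA₂⟩ : ∃ A₂ : ℝ, A₂ = (d + 1) * D2 hprof := ⟨_, rfl⟩
  obtain ⟨ap, hap⟩ : ∃ ap : ℝ, ap = (|aplus| + |a2plus|) * ((ℓ : ℝ) + 1) * Real.exp (δ * ((ℓ : ℝ) + 1)) :=
    ⟨_, rfl⟩
  have hA₁0 : 0 ≤ A₁ := by rw [hA₁]; positivity
  have hA₂0 : 0 ≤ A₂ := by rw [hA₂]; positivity
  have hap0 : 0 ≤ ap := by rw [hap]; positivity
  obtain ⟨EE, hEE⟩ : ∃ t : ℝ, t = Real.exp δ * Real.exp δ := ⟨_, rfl⟩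
  have hEE0 : 0 ≤ EE := by rw [hEE]; positivity
  have hcs0 := hcs.le
  have hcH0 := hcH.le
  have hc'0 := hc'.le
  have hcd0 := hcd.le
  obtain ⟨CP, hCP⟩ : ∃ t : ℝ, t = A₁ * (1 + Real.exp δ) * ((d + 1) * (A₁ * cs + cH))
      + (A₂ + ap * A₁) * (A₁ * c' + (2 * c' + ((d : ℝ) + 1) * Real.exp δ * cd)) := ⟨_, rfl⟩
  have hCP0 : 0 ≤ CP := by rw [hCP]; positivity
  refine ⟨((ℓ : ℝ) + 1) ^ 2 * EE * CP + 2 * ((ℓ : ℝ) + 1) ^ 2 * K₇ + 1, by positivity, ?_⟩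
  intro k Mh R hMh hR P hP D a c haw hcw y' lam B hlam x x' hne hblk cq hc
  obtain ⟨hi1, hij, hji, -, -⟩ := fin_data hc
  have hjk := hc.hj.2
  have hMh1 : 1 ≤ Mh := le_trans (by norm_num) hMh
  have hMhr : (1 : ℝ) ≤ Mh := by exact_mod_cast hMh1
  have hMh0 : (0 : ℝ) < Mh := by linarith
  have hB0 : 0 ≤ B := hlam.nonneg
  have hlamB : ∀ w, |lam w| ≤ B := fun w => BlockSupp.abs_le hlam w
  obtain ⟨dist0, hdist0⟩ : ∃ t : ℝ, t = (((bond D).dist (blkOf D x) y' : ℕ) : ℝ) := ⟨_, rfl⟩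
  have hgeom : (geom D).dist (blkOf D x) y' = dist0 := by rw [hdist0]; rfl
  have hgeom' : (geom D).dist (blkOf D x') y' = dist0 := by rw [hblk, hgeom]
  have hdist0nn : 0 ≤ dist0 := by rw [hdist0]; positivity
  rw [hgeom]
  obtain ⟨E6, hE6⟩ : ∃ t : ℝ, t = Real.exp (-(δ₆ / (d + 1) * dist0)) := ⟨_, rfl⟩
  rw [← hE6]
  have hE60 : 0 ≤ E6 := by rw [hE6]; exact (Real.exp_pos _).le
  have hE7 : Real.exp (-(δ₇ / (d + 1) * dist0)) ≤ E6 := by rw [hE6]; exact exp_rate_mono h67 hdist0nn d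
  obtain ⟨LJ, hLJ⟩ : ∃ t : ℝ, t = ((ℓ : ℝ) + 1) ^ D.lev x.1 := ⟨_, rfl⟩
  have hLJ0 : 0 < LJ := by rw [hLJ]; positivity
  have hLJα0 : 0 ≤ LJ ^ (1 - α) := Real.rpow_nonneg hLJ0.le _
  have hLJ1 : ((ℓ : ℝ) + 1) ^ (D.lev x.1 + 1) = ((ℓ : ℝ) + 1) * LJ := by rw [hLJ, pow_succ']
  have hRHS0 : 0 ≤ LJ ^ (1 - α)
      * ((((ℓ : ℝ) + 1) ^ 2 * EE * CP + 2 * ((ℓ : ℝ) + 1) ^ 2 * K₇ + 1) / Mh * E6 * B) := by positivity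
  obtain ⟨s, hs⟩ : ∃ t : ℝ, t = supNorm (x'.1 - x.1) := ⟨_, rfl⟩
  have hs1 : 1 ≤ s := by rw [hs]; exact B4StripSumsHolder.one_le_supNorm (sub_ne_zero.2 hne)
  have hs0 : 0 < s := lt_of_lt_of_le one_pos hs1
  have hW0 : 0 ≤ s ^ (-α) := Real.rpow_nonneg hs0.le _
  obtain ⟨g, hgdef⟩ : ∃ t : ↥(boxDom (N0 ℓ Mh k P)) → ℝ, t = levW D 1 *ᵥ lam := ⟨_, rfl⟩
  have hgz : ∀ z, g z = ((ℓ : ℝ) + 1) ^ D.lev z.1 * lam z := by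
    intro z; rw [hgdef]; unfold levW; rw [Matrix.mulVec_diagonal, zpow_one]
  have hcolx := hcol k Mh R hMh hR P hP D a c haw hcw y' lam B hlam x cq hc
  have hcolx' := hcol k Mh R hMh hR P hP D a c haw hcw y' lam B hlam x' cq hc
  rw [← hgdef, hgeom, hLJ1] at hcolx
  have hlevx' : D.lev x'.1 = D.lev x.1 := congrArg (fun s : ↥(bset D) => s.1.1) hblk
  rw [← hgdef, hgeom', hlevx', hLJ1] at hcolx'
  rw [← hgdef, ← hLJ, ← hs]
  -- the trivial case
  by_cases h0 : uX (ℓ := ℓ) (Mh := Mh) (k := k) (P := P) cq x = 0 ∧ uX (ℓ := ℓ) (Mh := Mh) (k := k) (P := P) cq x' = 0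
  · rw [bXt_col_eq_zero_of_uX (D := D) (a := a) (c := c) hP cq hc g h0.1,
      bXt_col_eq_zero_of_uX (D := D) (a := a) (c := c) hP cq hc g h0.2]
    simp only [sub_self, abs_zero, mul_zero]
    exact hRHS0
  have hu : uX (ℓ := ℓ) (Mh := Mh) (k := k) (P := P) cq x ≠ 0 ∨ uX (ℓ := ℓ) (Mh := Mh) (k := k) (P := P) cq x' ≠ 0 := by
    by_contra h'; push Not at h'; exact h0 ⟨h'.1, h'.2⟩
  -- the level window at `x`
  have hzval : ∀ w : ↥(boxDom (N0 ℓ Mh k P)), ((castP (ℓ := ℓ) (Mh := Mh) (P := P) hij hjk).symm w).1 = w.1 :=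
    fun w => by unfold castP; exact boxCast_symm_apply_val _ _
  have hinc : ∀ (w : ↥(boxDom (N0 ℓ Mh k P))) (bw : ↥(Box d ℓ (fin D cq.1 cq.2)
      (fun ν => (ℓ + 1) * cubeM' (MhP ℓ Mh cq.1 (fin D cq.1 cq.2)) (Pj ℓ k P cq.1) cq.2 ν))),
      embC D hP cq hc bw = (castP (ℓ := ℓ) (Mh := Mh) (P := P) hij hjk).symm w → InCube ℓ Mh k P cq.1 cq.2 w.1 :=
    fun w bw hbw => by rw [← hzval w]; exact (inCube_iff_exists_emb (Mh := Mh) hP hij hc.hq _).2 ⟨bw, hbw⟩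
  have hwin : fin D cq.1 cq.2 ≤ D.lev x.1 ∧ D.lev x.1 ≤ fin D cq.1 cq.2 + 1 := by
    rcases hu with h | h
    · obtain ⟨bw, hbw⟩ := img_of_uX_ne_zero hℓ hP hMh1 cq hc h (Or.inr rfl)
      exact lev_window_of_inCube hℓ hR hP hMh1 hc x.2 (hinc x bw hbw)
    · obtain ⟨bw, hbw⟩ := img_of_uX_ne_zero hℓ hP hMh1 cq hc h (Or.inr rfl)
      rw [← hlevx']; exact lev_window_of_inCube hℓ hR hP hMh1 hc x'.2 (hinc x' bw hbw)
  obtain ⟨nn, hnn⟩ : ∃ t : ℝ, t = (((ℓ + 1) ^ fin D cq.1 cq.2 : ℕ) : ℝ) := ⟨_, rfl⟩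
  have hncast : nn = ((ℓ : ℝ) + 1) ^ fin D cq.1 cq.2 := by rw [hnn]; push_cast; ring
  have hn1' : 1 ≤ (ℓ + 1) ^ fin D cq.1 cq.2 := Nat.one_le_pow _ _ (by omega)
  have hn1 : (1 : ℝ) ≤ nn := by rw [hnn]; exact_mod_cast hn1'
  have hn0 : (0 : ℝ) < nn := lt_of_lt_of_le one_pos hn1
  have hnLJ : nn ≤ LJ := by rw [hncast, hLJ]; exact pow_le_pow_right₀ hL1 hwin.1
  have hT : LJ ≤ ((ℓ : ℝ) + 1) * nn := by
    rw [hLJ, hncast, ← pow_succ']; exact pow_le_pow_right₀ hL1 hwin.2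
  obtain ⟨Nj, hNj⟩ : ∃ t : ℝ, t = (((ℓ + 1) ^ cq.1 : ℕ) : ℝ) := ⟨_, rfl⟩
  have hNj1' : 1 ≤ (ℓ + 1) ^ cq.1 := Nat.one_le_pow _ _ (by omega)
  have hNj0 : 0 < Nj := by rw [hNj]; exact_mod_cast hNj1'
  have hnNj : nn ≤ Nj := by
    rw [hnn, hNj]; exact_mod_cast Nat.pow_le_pow_right (by omega) hij
  obtain ⟨M, hM⟩ : ∃ M : ℝ, M = ((ℓ : ℝ) + 1) * Mh := ⟨_, rfl⟩
  have hM1 : (1 : ℝ) ≤ M := by rw [hM]; nlinarith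
  have hMpos : 0 < M := by linarith
  have hMhM : (Mh : ℝ) ≤ M := by rw [hM]; nlinarith
  have hM1n : 1 ≤ (ℓ + 1) * Mh := Nat.one_le_iff_ne_zero.2 (Nat.mul_ne_zero_iff.2 ⟨by omega, by omega⟩)
  have hMc : (((ℓ + 1) * Mh : ℕ) : ℝ) = M := by rw [hM]; push_cast; ring
  -- the Hölder weights of both regimes: `w^{−α}·L^{j+1} ≤ L²(L^j)^{1−α}` for `n ≤ w`
  have hfarW : ∀ w : ℝ, nn ≤ w → w ^ (-α) * (((ℓ : ℝ) + 1) * LJ) ≤ ((ℓ : ℝ) + 1) ^ 2 * LJ ^ (1 - α) := by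
    intro w hw
    have h := rpow_far_le hn0 hw hLJ0 hT hL1 hα0 hα1.le
    calc w ^ (-α) * (((ℓ : ℝ) + 1) * LJ) = ((ℓ : ℝ) + 1) * (w ^ (-α) * LJ) := by ring
      _ ≤ ((ℓ : ℝ) + 1) * (((ℓ : ℝ) + 1) * LJ ^ (1 - α)) := mul_le_mul_of_nonneg_left h hL0.le
      _ = ((ℓ : ℝ) + 1) ^ 2 * LJ ^ (1 - α) := by ring
  have hQ1 : ((ℓ : ℝ) + 1) ^ 2 * EE * CP ≤ ((ℓ : ℝ) + 1) ^ 2 * EE * CP + 2 * ((ℓ : ℝ) + 1) ^ 2 * K₇ + 1 := by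
    have : 0 ≤ 2 * ((ℓ : ℝ) + 1) ^ 2 * K₇ := by positivity
    linarith
  have hQ2 : 2 * ((ℓ : ℝ) + 1) ^ 2 * K₇ ≤ ((ℓ : ℝ) + 1) ^ 2 * EE * CP + 2 * ((ℓ : ℝ) + 1) ^ 2 * K₇ + 1 := by
    have : 0 ≤ ((ℓ : ℝ) + 1) ^ 2 * EE * CP := by positivity
    linarith
  by_cases hnear : s ≤ nn
  · -- NEAR PAIRS: both points lie in the cube image
    obtain ⟨b, b', hb, hb'⟩ : ∃ b b', embC D hP cq hc b = (castP (ℓ := ℓ) (Mh := Mh) (P := P) hij hjk).symm x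
        ∧ embC D hP cq hc b' = (castP (ℓ := ℓ) (Mh := Mh) (P := P) hij hjk).symm x' := by
      have hd1 : supNorm (x'.1 - x.1) ≤ 2 * (((ℓ + 1) ^ fin D cq.1 cq.2 : ℕ) : ℝ) := by
        rw [← hs, ← hnn]; linarith only [hnear, hn0]
      have hd2 : supNorm (x.1 - x'.1) ≤ 2 * (((ℓ + 1) ^ fin D cq.1 cq.2 : ℕ) : ℝ) := by
        rw [supNorm_sub_comm]; exact hd1
      have hd0 : ∀ w : ↥(boxDom (N0 ℓ Mh k P)), supNorm (w.1 - w.1) ≤ 2 * (((ℓ + 1) ^ fin D cq.1 cq.2 : ℕ) : ℝ) := by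
        intro w
        have h0' : supNorm (w.1 - w.1) = 0 := by rw [sub_self]; unfold B4ContourShift.supNorm; simp
        rw [h0']; positivity
      rcases hu with h | h
      · obtain ⟨b, hb⟩ := img_of_near hℓ hP hMh cq hc h (hd0 x)
        obtain ⟨b', hb'⟩ := img_of_near hℓ hP hMh cq hc h hd1
        exact ⟨b, b', hb, hb'⟩
      · obtain ⟨b, hb⟩ := img_of_near hℓ hP hMh cq hc h hd2
        obtain ⟨b', hb'⟩ := img_of_near hℓ hP hMh cq hc h (hd0 x')
        exact ⟨b, b', hb, hb'⟩
    have hbx : (embC D hP cq hc b).1 = x.1 := by rw [hb, hzval]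
    have hb'x : (embC D hP cq hc b').1 = x'.1 := by rw [hb', hzval]
    have hsubE : ∀ u v, (embC D hP cq hc u).1 - (embC D hP cq hc v).1 = u.1 - v.1 := fun u v => by
      unfold embC; exact emb_sub_emb _ hc.hq u v
    have hb'b : b'.1 - b.1 = x'.1 - x.1 := by rw [← hsubE b' b, hb'x, hbx]
    have hsb : supNorm (b'.1 - b.1) = s := by rw [hb'b, hs]
    have hneb : b'.1 ≠ b.1 := fun h => hne (by
      have := hb'b; rw [h, sub_self] at this; exact (sub_eq_zero.1 this.symm))
    have hxin : InCube ℓ Mh k P cq.1 cq.2 x.1 := hinc x b hb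
    have hx'in : InCube ℓ Mh k P cq.1 cq.2 x'.1 := hinc x' b' hb'
    -- the per-cube inputs
    have hMh' : 1 ≤ MhP ℓ Mh cq.1 (fin D cq.1 cq.2) := one_le_MhP hMh1 _ _
    have hMhle : Mh ≤ MhP ℓ Mh cq.1 (fin D cq.1 cq.2) := by
      unfold MhP; exact Nat.le_mul_of_pos_right _ (Nat.one_le_pow _ _ (by omega))
    have hcM' : ∀ ν, 1 ≤ cubeM' (MhP ℓ Mh cq.1 (fin D cq.1 cq.2)) (Pj ℓ k P cq.1) cq.2 ν := fun ν =>
      Nat.one_le_iff_ne_zero.2 (Nat.mul_ne_zero_iff.2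
        ⟨by omega, by have := (one_le_cubeW (one_le_Pj hP cq.1) hc.hq ν).1; omega⟩)
    have haj : 0 < a (fin D cq.1 cq.2) := lt_of_lt_of_le ha (haw _ hi1).1
    have hc0 : 0 ≤ c (fin D cq.1 cq.2) := (lt_of_lt_of_le ha2 (hcw _ hi1).1).le
    obtain ⟨M', hM'⟩ : ∃ M' : ℝ, M' = ((ℓ : ℝ) + 1) * (MhP ℓ Mh cq.1 (fin D cq.1 cq.2) : ℝ) := ⟨_, rfl⟩
    have hMM' : M ≤ M' := by
      rw [hM, hM']; exact mul_le_mul_of_nonneg_left (by exact_mod_cast hMhle) hL0.le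
    have hM'pos : 0 < M' := lt_of_lt_of_le hMpos hMM'
    obtain ⟨κ₁, hκ₁⟩ : ∃ κ₁ : ℝ, κ₁ = A₁ / M' := ⟨_, rfl⟩
    obtain ⟨κ₂, hκ₂⟩ : ∃ κ₂ : ℝ, κ₂ = (d + 1) * (D2 hprof / M' ^ 2) := ⟨_, rfl⟩
    obtain ⟨κ, hκ⟩ : ∃ κ : ℝ, κ = A₁ / M := ⟨_, rfl⟩
    have hκ₁0 : 0 ≤ κ₁ := by rw [hκ₁]; positivity
    have hκ₂0 : 0 ≤ κ₂ := by rw [hκ₂]; positivity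
    have hκ0 : 0 ≤ κ := by rw [hκ]; positivity
    have hG : ∀ w, roww δ ((ℓ + 1) ^ fin D cq.1 cq.2) (cG D a c cq.1 (fin D cq.1 cq.2) cq.2 hP hc.hq) w ≤ c' :=
      fun w => (roww_mono h1a _ _ _).trans (h243 (fin D cq.1 cq.2) hi1 (a (fin D cq.1 cq.2)) 0 (c (fin D cq.1 cq.2))
        (haw _ hi1).1 (haw _ hi1).2 le_rfl le_rfl (hcw _ hi1).1 (hcw _ hi1).2 _ hcM' _ w)
    have hGs : ∀ (μ : Fin (d + 1)) w, roww δ ((ℓ + 1) ^ fin D cq.1 cq.2)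
        (dstar ((ℓ + 1) ^ fin D cq.1 cq.2) μ (cG D a c cq.1 (fin D cq.1 cq.2) cq.2 hP hc.hq)) w ≤ cs :=
      fun μ w => (roww_mono h1s _ _ _).trans (h243s (fin D cq.1 cq.2) hi1 (a (fin D cq.1 cq.2)) 0
        (c (fin D cq.1 cq.2)) (haw _ hi1).1 (haw _ hi1).2 le_rfl le_rfl (hcw _ hi1).1 (hcw _ hi1).2 _ hcM'
        (lamLoc ℓ (MhP ℓ Mh cq.1 (fin D cq.1 cq.2)) (Pj ℓ k P cq.1) cq.2 (one_le_Pj hP cq.1) hc.hq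
          (LamG D cq.1 (fin D cq.1 cq.2))) μ w)
    have hGd : ∀ (i : Fin (d + 1)) (v ve : ↥(Box d ℓ (fin D cq.1 cq.2)
        (fun ν => (ℓ + 1) * cubeM' (MhP ℓ Mh cq.1 (fin D cq.1 cq.2)) (Pj ℓ k P cq.1) cq.2 ν))),
        ve.1 = v.1 + Pi.single i 1 →
        wsum δ ((ℓ + 1) ^ fin D cq.1 cq.2) v (fun z => (((ℓ + 1) ^ fin D cq.1 cq.2 : ℕ) : ℝ)
          * (cG D a c cq.1 (fin D cq.1 cq.2) cq.2 hP hc.hq ve z - cG D a c cq.1 (fin D cq.1 cq.2) cq.2 hP hc.hq v z))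
          ≤ cd :=
      fun i v ve hve => (wsum_mono_rate h1d _ _ _).trans (h243d (fin D cq.1 cq.2) hi1 (a (fin D cq.1 cq.2)) 0
        (c (fin D cq.1 cq.2)) (haw _ hi1).1 (haw _ hi1).2 le_rfl le_rfl (hcw _ hi1).1 (hcw _ hi1).2 _ hcM' _ i
        v ve hve)
    have hTT : ∀ μ : Fin (d + 1), wsum2 δ ((ℓ + 1) ^ fin D cq.1 cq.2) b b' (fun w =>
        ((((ℓ + 1) ^ fin D cq.1 cq.2 : ℕ) : ℝ) / supNorm (b'.1 - b.1)) ^ α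
          * ((((ℓ + 1) ^ fin D cq.1 cq.2 : ℕ) : ℝ)
            * ((cG D a c cq.1 (fin D cq.1 cq.2) cq.2 hP hc.hq b' (fwd _ μ w)
                - cG D a c cq.1 (fin D cq.1 cq.2) cq.2 hP hc.hq b' w)
              - (cG D a c cq.1 (fin D cq.1 cq.2) cq.2 hP hc.hq b (fwd _ μ w)
                - cG D a c cq.1 (fin D cq.1 cq.2) cq.2 hP hc.hq b w)))) ≤ cH :=
      fun μ => (wsum2_mono_rate h1H _ _ _ _).trans (hH (fin D cq.1 cq.2) hi1 (a (fin D cq.1 cq.2)) 0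
        (c (fin D cq.1 cq.2)) (haw _ hi1).1 (haw _ hi1).2 le_rfl le_rfl (hcw _ hi1).1 (hcw _ hi1).2 _ hcM' _ μ
        b b' hneb)
    -- the input vector on the cube image: bound and support distances
    have hgG : ∀ z, |g (castP (fin_data hc).2.1 hc.hj.2 (embC D hP cq hc z))| ≤ ((ℓ : ℝ) + 1) * LJ * B := by
      intro z
      rw [hgz, abs_mul, abs_of_nonneg (by positivity)]
      set x'' : ↥(boxDom (N0 ℓ Mh k P)) := castP (fin_data hc).2.1 hc.hj.2 (embC D hP cq hc z) with hx''
      have hx''val : x''.1 = (embC D hP cq hc z).1 := by rw [hx'']; unfold castP; exact boxCast_apply_val _ _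
      have hx''in : InCube ℓ Mh k P cq.1 cq.2 x''.1 := by
        rw [hx''val]; exact (inCube_iff_exists_emb (Mh := Mh) hP hij hc.hq _).2 ⟨z, rfl⟩
      have hlev'' := lev_window_of_inCube hℓ hR hP hMh1 hc x''.2 hx''in
      have hpow : ((ℓ : ℝ) + 1) ^ D.lev x''.1 ≤ ((ℓ : ℝ) + 1) * LJ := by
        rw [← hLJ1]; exact pow_le_pow_right₀ hL1 (by omega)
      exact mul_le_mul hpow (hlamB _) (abs_nonneg _) (by positivity)
    obtain ⟨Dd, hDd⟩ : ∃ t : ℝ, t = nn * (dist0 / (d + 1) - 1) := ⟨_, rfl⟩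
    have hDgen : ∀ (w : ↥(boxDom (N0 ℓ Mh k P))) (bw : ↥(Box d ℓ (fin D cq.1 cq.2)
        (fun ν => (ℓ + 1) * cubeM' (MhP ℓ Mh cq.1 (fin D cq.1 cq.2)) (Pj ℓ k P cq.1) cq.2 ν))),
        (embC D hP cq hc bw).1 = w.1 → InCube ℓ Mh k P cq.1 cq.2 w.1 → (geom D).dist (blkOf D w) y' = dist0 →
        ∀ z, g (castP (fin_data hc).2.1 hc.hj.2 (embC D hP cq hc z)) ≠ 0 → Dd ≤ supNorm (bw.1 - z.1) := by
      intro w bw hbw hwin' hwd z hz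
      set x'' : ↥(boxDom (N0 ℓ Mh k P)) := castP (fin_data hc).2.1 hc.hj.2 (embC D hP cq hc z) with hx''
      have hμx : lam x'' ≠ 0 := by
        intro h0'; apply hz; rw [hgz, h0', mul_zero]
      have hx''val : x''.1 = (embC D hP cq hc z).1 := by
        rw [hx'']; unfold castP; exact boxCast_apply_val _ _
      have hx''in : InCube ℓ Mh k P cq.1 cq.2 x''.1 := by
        rw [hx''val]
        exact (inCube_iff_exists_emb (Mh := Mh) hP hij hc.hq _).2 ⟨z, rfl⟩
      have hblk'' : blkOf D x'' = y' := by
        by_contra hne'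
        exact hμx (hlam.off x'' hne')
      have h := Dd_le_supNorm hℓ hR hP hMh1 hc w x'' hwin' hx''in y' hblk''
      have hsub : w.1 - x''.1 = bw.1 - z.1 := by rw [hx''val, ← hbw]; exact hsubE bw z
      rw [hsub] at h
      have hd' : (((bond D).dist (blkOf D w) y' : ℕ) : ℝ) = dist0 := hwd
      rw [hd', ← hnn, ← hDd] at h
      exact h
    have hD_b := hDgen x b hbx hxin hgeom
    have hD_b' := hDgen x' b' hb'x hx'in hgeom'
    -- the jump of the cut-off between the two columns
    have htt : |vX D cq x' - vX D cq x| ≤ κ * supNorm (b'.1 - b.1) / (((ℓ + 1) ^ fin D cq.1 cq.2 : ℕ) : ℝ) := by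
      refine (abs_vX_sub_le (D := D) cq hlevx').trans ?_
      have h := abs_hq_sub_le (d := d) hNj1' hM1n cq.2 x.1 x'.1
      rw [← hNj, ← hs, hMc] at h
      rw [hsb, ← hnn, hκ, hA₁]
      refine h.trans ?_
      exact div_le_div_of_nonneg_left (by positivity) hn0 hnNj
    have key := bXt_pair_near_le (D := D) (a := a) (c := c) hP cq hc hα0 hα1.le hδpos.le hc'0 hcd0 hκ0 hκ₁0 hκ₂0
      haj hc0 hG hGd hGs
      (fun z z' => by rw [hκ₁, hA₁, hM']; exact hLoc_lipschitz hMh' cq.2 z z')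
      (fun z => by rw [hκ₂, hM']; exact hLoc_laplacian_le hℓ hi1 hMh' (one_le_Pj hP cq.1) hc.hq z)
      g (by positivity) hgG hb hb' hneb (by rw [hsb, ← hnn]; exact hnear) htt hTT hD_b hD_b'
    rw [hsb, ← hnn] at key
    -- sizes: `A ≤ C_P/M`, `e^{−δD/n} ≤ e^{2δ}E`, `n^{−α}L^{j+1} ≤ L²(L^j)^{1−α}`
    have hκ₁' : κ₁ ≤ A₁ / M := by rw [hκ₁]; exact div_le_div_of_nonneg_left hA₁0 hMpos hMM'
    have hκ' : κ ≤ A₁ := by rw [hκ]; exact div_le_self hA₁0 hM1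
    have hκ₂' : κ₂ ≤ A₂ / M := by
      rw [hκ₂, hA₂]
      have hM'1 : (1 : ℝ) ≤ M' := hM1.trans hMM'
      have hM2 : D2 hprof / M' ^ 2 ≤ D2 hprof / M := by
        apply div_le_div_of_nonneg_left hD2 hMpos
        calc M ≤ M' := hMM'
          _ = M' * 1 := (mul_one _).symm
          _ ≤ M' * M' := mul_le_mul_of_nonneg_left hM'1 hM'pos.le
          _ = M' ^ 2 := (sq _).symm
      calc ((d : ℝ) + 1) * (D2 hprof / M' ^ 2) ≤ (d + 1) * (D2 hprof / M) :=
            mul_le_mul_of_nonneg_left hM2 (by positivity)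
        _ = (d + 1) * D2 hprof / M := mul_div_assoc' _ _ _
    have hajp : (a (fin D cq.1 cq.2) + c (fin D cq.1 cq.2)) * ((ℓ : ℝ) + 1) * Real.exp (δ * ((ℓ : ℝ) + 1)) ≤ ap := by
      rw [hap]
      have : a (fin D cq.1 cq.2) + c (fin D cq.1 cq.2) ≤ |aplus| + |a2plus| :=
        add_le_add ((haw _ hi1).2.trans (le_abs_self _)) ((hcw _ hi1).2.trans (le_abs_self _))
      exact mul_le_mul_of_nonneg_right (mul_le_mul_of_nonneg_right this hL0.le) (Real.exp_pos _).le
    have hAle : κ₁ * (1 + Real.exp δ) * ((d + 1) * (κ * cs + cH))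
        + (κ₂ + (a (fin D cq.1 cq.2) + c (fin D cq.1 cq.2)) * ((ℓ : ℝ) + 1) * Real.exp (δ * ((ℓ : ℝ) + 1)) * κ₁)
          * (κ * c' + (2 * c' + ((d : ℝ) + 1) * Real.exp δ * cd)) ≤ CP / M := by
      have t1 : κ₁ * (1 + Real.exp δ) * ((d + 1) * (κ * cs + cH))
          ≤ A₁ / M * (1 + Real.exp δ) * ((d + 1) * (A₁ * cs + cH)) :=
        mul_le_mul (mul_le_mul_of_nonneg_right hκ₁' (by positivity))
          (mul_le_mul_of_nonneg_left (add_le_add (mul_le_mul_of_nonneg_right hκ' hcs0) le_rfl) (by positivity))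
          (by positivity) (by positivity)
      have t2 : (κ₂ + (a (fin D cq.1 cq.2) + c (fin D cq.1 cq.2)) * ((ℓ : ℝ) + 1) * Real.exp (δ * ((ℓ : ℝ) + 1)) * κ₁)
          * (κ * c' + (2 * c' + ((d : ℝ) + 1) * Real.exp δ * cd))
          ≤ (A₂ / M + ap * (A₁ / M)) * (A₁ * c' + (2 * c' + ((d : ℝ) + 1) * Real.exp δ * cd)) :=
        mul_le_mul (add_le_add hκ₂' (mul_le_mul hajp hκ₁' hκ₁0 hap0))
          (add_le_add (mul_le_mul_of_nonneg_right hκ' hc'0) le_rfl) (by positivity) (by positivity)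
      refine (add_le_add t1 t2).trans (le_of_eq ?_)
      rw [hCP]
      field_simp
    have hA0 : 0 ≤ κ₁ * (1 + Real.exp δ) * ((d + 1) * (κ * cs + cH))
        + (κ₂ + (a (fin D cq.1 cq.2) + c (fin D cq.1 cq.2)) * ((ℓ : ℝ) + 1) * Real.exp (δ * ((ℓ : ℝ) + 1)) * κ₁)
          * (κ * c' + (2 * c' + ((d : ℝ) + 1) * Real.exp δ * cd)) := by positivity
    have hexp : Real.exp (-(δ * Dd / nn)) ≤ EE * E6 := by
      rw [hDd, hEE, hE6]; exact exp_Dd_le hδpos.le h6δ hn1 hdist0nn d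
    have hnw := hfarW nn le_rfl
    calc s ^ (-α) * |((bX D a c hP cq hc)ᵀ *ᵥ g) x' - ((bX D a c hP cq hc)ᵀ *ᵥ g) x|
        ≤ nn ^ (-α) * (κ₁ * (1 + Real.exp δ) * ((d + 1) * (κ * cs + cH))
            + (κ₂ + (a (fin D cq.1 cq.2) + c (fin D cq.1 cq.2)) * ((ℓ : ℝ) + 1) * Real.exp (δ * ((ℓ : ℝ) + 1)) * κ₁)
              * (κ * c' + (2 * c' + ((d : ℝ) + 1) * Real.exp δ * cd)))
            * Real.exp (-(δ * Dd / nn)) * (((ℓ : ℝ) + 1) * LJ * B) := key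
      _ = (nn ^ (-α) * (((ℓ : ℝ) + 1) * LJ)) * (κ₁ * (1 + Real.exp δ) * ((d + 1) * (κ * cs + cH))
            + (κ₂ + (a (fin D cq.1 cq.2) + c (fin D cq.1 cq.2)) * ((ℓ : ℝ) + 1) * Real.exp (δ * ((ℓ : ℝ) + 1)) * κ₁)
              * (κ * c' + (2 * c' + ((d : ℝ) + 1) * Real.exp δ * cd)))
            * (Real.exp (-(δ * Dd / nn)) * B) := by ring
      _ ≤ (((ℓ : ℝ) + 1) ^ 2 * LJ ^ (1 - α)) * (CP / M) * ((EE * E6) * B) :=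
          mul_le_mul (mul_le_mul hnw hAle hA0 (by positivity)) (mul_le_mul_of_nonneg_right hexp hB0)
            (by positivity) (by positivity)
      _ = LJ ^ (1 - α) * ((((ℓ : ℝ) + 1) ^ 2 * EE * CP) / M * E6 * B) := by ring
      _ ≤ LJ ^ (1 - α) * ((((ℓ : ℝ) + 1) ^ 2 * EE * CP) / Mh * E6 * B) := by
          refine mul_le_mul_of_nonneg_left (mul_le_mul_of_nonneg_right (mul_le_mul_of_nonneg_right
            (div_le_div_of_nonneg_left (by positivity) hMh0 hMhM) hE60) hB0) hLJα0
      _ ≤ LJ ^ (1 - α)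
          * ((((ℓ : ℝ) + 1) ^ 2 * EE * CP + 2 * ((ℓ : ℝ) + 1) ^ 2 * K₇ + 1) / Mh * E6 * B) := by
          refine mul_le_mul_of_nonneg_left (mul_le_mul_of_nonneg_right (mul_le_mul_of_nonneg_right
            (div_le_div_of_nonneg_right hQ1 hMh0.le) hE60) hB0) hLJα0
  · -- FAR PAIRS: two single columns
    have hns : nn ≤ s := by push Not at hnear; exact hnear.le
    have hsw := hfarW s hns
    calc s ^ (-α) * |((bX D a c hP cq hc)ᵀ *ᵥ g) x' - ((bX D a c hP cq hc)ᵀ *ᵥ g) x|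
        ≤ s ^ (-α) * (((ℓ : ℝ) + 1) * LJ * (K₇ / Mh * Real.exp (-(δ₇ / (d + 1) * dist0)) * B)
            + ((ℓ : ℝ) + 1) * LJ * (K₇ / Mh * Real.exp (-(δ₇ / (d + 1) * dist0)) * B)) :=
          mul_le_mul_of_nonneg_left ((abs_sub _ _).trans (add_le_add hcolx' hcolx)) hW0
      _ = (s ^ (-α) * (((ℓ : ℝ) + 1) * LJ)) * (2 * (K₇ / Mh) * Real.exp (-(δ₇ / (d + 1) * dist0)) * B) := by ring
      _ ≤ (((ℓ : ℝ) + 1) ^ 2 * LJ ^ (1 - α)) * (2 * (K₇ / Mh) * E6 * B) :=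
          mul_le_mul hsw (mul_le_mul_of_nonneg_right (mul_le_mul_of_nonneg_left hE7 (by positivity)) hB0)
            (by positivity) (by positivity)
      _ = LJ ^ (1 - α) * ((2 * ((ℓ : ℝ) + 1) ^ 2 * K₇) / Mh * E6 * B) := by ring
      _ ≤ LJ ^ (1 - α)
          * ((((ℓ : ℝ) + 1) ^ 2 * EE * CP + 2 * ((ℓ : ℝ) + 1) ^ 2 * K₇ + 1) / Mh * E6 * B) := by
          refine mul_le_mul_of_nonneg_left (mul_le_mul_of_nonneg_right (mul_le_mul_of_nonneg_right
            (div_le_div_of_nonneg_right hQ2 hMh0.le) hE60) hB0) hLJα0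

end ColPair

end

end Literature.MathematicalPhysics.QuantumFieldTheory.Balaban1983to89.B6DualHolderTermMultiLevelBoxRateUnif
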